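import Literature.Analysis.ValidatedNumerics.ParametricIntervalMatrixPosSemidef
import Literature.Analysis.ValidatedNumerics.MatrixEigenEnclosure
import HarnessLib

/-!
# Eigenvalue MARGINS of an affine symmetric matrix family over a parameter box are decided at the
# `2^K` box vertices (the certificate-reader form of Hladík 2017, Thm. 7)

Topic `Literature/Analysis/ValidatedNumerics`. HONEST FRAMING (cell certnum, seat certnum-sdp-4,
layer L2 «certified eigenvalue-optimisation margins»): this file is the SOUNDNESS STATEMENT behind
the vertex method of the margin call `sdp.min_eig_margin` (design note
`run/shared/lean/pub/certnum/sdp/DESIGN-eigopt.md` §2 M1, gap G1); it produces no number — every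
certified number belongs to a client cell's ledger. Everything here is proved; no named facts, no
instance, no new axiom.

THE STATEMENT. For an AFFINE family `p ↦ A₀ + Σ_k p_k A^{(k)}` of real matrices and a box
`p ∈ [p̲, p̄]`: if a uniform form bound `lam · ‖x‖² ≤ xᵀ(A₀ + A(p))x` holds at every VERTEX of the box
then it holds at every point of the box (`mul_dotProduct_affine_ge_of_forall_vertex`); hence for
symmetric data every eigenvalue of `A₀ + A(p)` is `≥ lam` for every `p` in the box as soon as this is
true at the `2^K` vertices (`le_eigenvalues_affine_of_forall_vertex`,
`le_eigenvalues_affine_of_forall_vertex_eigenvalues`), and the two conditions are equivalent when the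
box is non-empty (`forall_mem_le_eigenvalues_affine_iff_forall_vertex`). In words: `p ↦ λ_min(A₀ + A(p))`
is a minimum of affine functions of `p`, hence concave, so its minimum over a box is attained at a
vertex; the proof here is Hladík's sign-vertex argument (`form_signVertex_le_form` of
`ParametricIntervalMatrixPosSemidef.lean`) applied to the linear part, the constant term `A₀`
cancelling — Hladík's Theorem 7 is the case `A₀ = 0`, `lam = 0`, strict.

HOW A CONSUMER USES IT. A compute job certifies, for each vertex `v`, the form bound with
`lam_v ≥ lam` by an `LDLᵀ` certificate of the point matrix `A₀ + A(v)` (kernel checker `checkLower`,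
theorem `mul_dotProduct_le_of_checkLower` of `MatrixEigenEnclosure.lean`, radii `Δ = 0` or the data
radii), and this file turns the `2^K` vertex facts into `lam ≤ λᵢ(A₀ + A(p))` for EVERY `p` of the box —
the «margin `m_lo`» of the design note. Monotone parameters may be frozen beforehand by
`forall_mem_form_nonneg_iff_face_lo/hi` (Hladík Thm. 4) applied to the shifted family.

RELATION TO THE TREE (searched 2026-08-26): the corner argument itself is already in the tree twice —
`ParametricIntervalPosSemidef.form_signVertex_le_form` (Hladík's `[p̲, p̄]` box, linear family, which
this file CALLS; nothing is re-proved) and `AffineCornerTest.form_nonneg_on_box` (centre/half-width box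
`|k_j − k₀_j| ≤ h_j`, sign corners `ε ∈ {±1}^d`, with a uniform remainder bound `R`, form `≥ 0`
packaging). What is added here is only the PACKAGING a margin certificate reader needs and neither file
states: the constant term `A₀`, an explicit margin `lam`, the conclusions as
`Matrix.IsHermitian.eigenvalues` bounds, and the `iff` (vertices ⇔ box) in the `IsBoxVertex lo hi`
vocabulary of the Hladík file.

NOT COVERED: non-affine dependence on `p` (then `λ_min` need not be concave and vertices do NOT
decide — use the kd-tree scan `ParametricEigenScan.lean`, or `AffineCornerTest` with a remainder
bound); interior eigenvalues `λ_k`, `k ≥ 2` (neither concave nor convex in `p`); anything about an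
operator the matrix family discretises; the float computation that proposed the certificates.

PENCILS (appended 2026-08-26, design note §1 S4 «discrete energy-principle margin
`δW_h[ξ] ≥ m‖ξ‖²_K`»). For TWO affine symmetric families `W(p) = W₀ + Σ p_k W^{(k)}`,
`K(p) = K₀ + Σ p_k K^{(k)}` and a FIXED margin `m`, the family `W(p) − m·K(p)` is again affine, so the
same vertex argument gives: `m · xᵀK(v)x ≤ xᵀW(v)x` at the `2^K` vertices ⇒ at every `p` of the box
(`pencil_form_ge_affine_of_forall_vertex`, `forall_mem_pencil_form_ge_affine_iff_forall_vertex`);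
with `K(p)` positive on the box (itself decided at the vertices with a margin `κ > 0`) this is the
generalised Rayleigh-quotient bound `m ≤ xᵀW(p)x / xᵀK(p)x`, `x ≠ 0`, i.e. every generalised
eigenvalue of the symmetric-definite pencil `(W(p), K(p))` is `≥ m`
(`le_pencil_rayleigh_affine_of_forall_vertex`). NOTE the margin `m` is fixed BEFORE the vertex test:
`p ↦ λ₁(W(p), K(p))` is a minimum of RATIOS of affine functions and need not be concave when `K`
varies, so «min over vertices of `λ₁`» is a candidate, certified only by the second pass at all
vertices with that `m`.

## References

* M. Hladík, *Positive semidefiniteness and positive definiteness of a linear parametric interval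
  matrix*, in: Constraint Programming and Decision Making: Theory and Applications, Springer (2017)
  77–88 = arXiv:1704.05782, Thm. 7 and the proof of Thm. 3 ((2) ⇒ (3) ⇒ (1), the sign vertex
  `p_k := p^c_k − sgn(xᵀA^{(k)}x) p^Δ_k`), read on pp. 4–6 of the held arXiv text 2026-08-26.
  [cite: Hladik2017, Thm. 7]
* I. Skalna, M. Hladík, *Positive definiteness and stability of parametric interval matrices*,
  arXiv:1709.00853 (2017), Thm. 4.2 (ii) "vertex property" for stability of a symmetric parametric
  family, read on p. 6 of the held text (arXiv:1709.00853; no bib key — cited for context only).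
-/

open scoped Matrix
open Finset

namespace Literature.Analysis.ValidatedNumerics

namespace ParametricEigenMargin

open _root_.Matrix ParametricIntervalPosSemidef

variable {n : Type*} [Fintype n] [DecidableEq n] {ι : Type*} [Fintype ι]

/-! ### The form of an affine family and the sign vertex -/

omit [DecidableEq n] in
/-- The quadratic form of the affine family splits as constant part plus linear part:
`xᵀ(A₀ + A(p))x = xᵀA₀x + xᵀA(p)x` (plumbing). [folklore] -/
private theorem form_affine_eq (A₀ : Matrix n n ℝ) (A : ι → Matrix n n ℝ) (p : ι → ℝ) (x : n → ℝ) :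
    x ⬝ᵥ (A₀ + paramMatrix A p) *ᵥ x = x ⬝ᵥ A₀ *ᵥ x + x ⬝ᵥ paramMatrix A p *ᵥ x := by
  rw [Matrix.add_mulVec, dotProduct_add]

omit [DecidableEq n] in
/-- **The sign vertex of `x` minimises the form of the AFFINE family over the box**: for
`p ∈ [p̲, p̄]`, `xᵀ(A₀ + A(p_x))x ≤ xᵀ(A₀ + A(p))x` with `p_x` Hladík's sign vertex of `x` (the
constant term cancels). [cite: Hladik2017, Thm. 3 (proof, sign vertex)] -/
theorem form_affine_signVertex_le_form (A₀ : Matrix n n ℝ) (A : ι → Matrix n n ℝ) {lo hi p : ι → ℝ}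
    (hp : p ∈ Set.Icc lo hi) (x : n → ℝ) :
    x ⬝ᵥ (A₀ + paramMatrix A (signVertex A lo hi x)) *ᵥ x ≤ x ⬝ᵥ (A₀ + paramMatrix A p) *ᵥ x := by
  rw [form_affine_eq, form_affine_eq]
  exact add_le_add_right (form_signVertex_le_form A hp x) _

/-! ### Form margins: vertices decide -/

omit [DecidableEq n] in
/-- **Uniform form margin of an affine family over a box from its vertices.** If
`lam · (x ⬝ᵥ x) ≤ xᵀ(A₀ + A(v))x` for every vertex `v` of the box `[p̲, p̄]` and every `x`, then the
same bound holds at every `p ∈ [p̲, p̄]` (evaluate the hypothesis at the sign vertex of `x`). No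
symmetry is needed for this inequality. [cite: Hladik2017, Thm. 7 ((2) ⇒ (1)), margin form] -/
theorem mul_dotProduct_affine_ge_of_forall_vertex (A₀ : Matrix n n ℝ) (A : ι → Matrix n n ℝ)
    {lo hi : ι → ℝ} {lam : ℝ}
    (hv : ∀ q, IsBoxVertex lo hi q → ∀ x : n → ℝ, lam * (x ⬝ᵥ x) ≤ x ⬝ᵥ (A₀ + paramMatrix A q) *ᵥ x)
    {p : ι → ℝ} (hp : p ∈ Set.Icc lo hi) (x : n → ℝ) :
    lam * (x ⬝ᵥ x) ≤ x ⬝ᵥ (A₀ + paramMatrix A p) *ᵥ x :=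
  (hv _ (isBoxVertex_signVertex A lo hi x) x).trans (form_affine_signVertex_le_form A₀ A hp x)

omit [DecidableEq n] in
/-- **Vertices ⇔ box for form margins** (box non-empty, `p̲ ≤ p̄`): the uniform bound
`lam · ‖x‖² ≤ xᵀ(A₀ + A(p))x` holds for all `p` in the box iff it holds at the `2^K` vertices.
[cite: Hladik2017, Thm. 7 ((1) ⇔ (2)), margin form] -/
theorem forall_mem_form_ge_affine_iff_forall_vertex (A₀ : Matrix n n ℝ) (A : ι → Matrix n n ℝ)
    {lo hi : ι → ℝ} (hlh : lo ≤ hi) (lam : ℝ) :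
    (∀ p ∈ Set.Icc lo hi, ∀ x : n → ℝ, lam * (x ⬝ᵥ x) ≤ x ⬝ᵥ (A₀ + paramMatrix A p) *ᵥ x) ↔
      ∀ q, IsBoxVertex lo hi q → ∀ x : n → ℝ, lam * (x ⬝ᵥ x) ≤ x ⬝ᵥ (A₀ + paramMatrix A q) *ᵥ x :=
  ⟨fun h q hq x => h q (hq.mem_Icc hlh) x,
    fun h _ hp x => mul_dotProduct_affine_ge_of_forall_vertex A₀ A h hp x⟩

/-! ### Eigenvalue margins (symmetric data) -/

omit [Fintype n] [DecidableEq n] in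
/-- The affine family is symmetric when `A₀` and every `A^{(k)}` are ("`A^{(1)}, …, A^{(K)}` are fixed
symmetric matrices"). [cite: Hladik2017, §2 (definition of `A(p)`)] -/
theorem isHermitian_affine {A₀ : Matrix n n ℝ} {A : ι → Matrix n n ℝ} (hA₀ : A₀.IsHermitian)
    (hA : ∀ k, (A k).IsHermitian) (p : ι → ℝ) : (A₀ + paramMatrix A p).IsHermitian :=
  hA₀.add (isHermitian_paramMatrix hA p)

/-- **Rayleigh–Ritz, lower direction (real symmetric case)**: a uniform lower bound of the quadratic
form, `lam · xᵀx ≤ xᵀMx` for all `x`, bounds every eigenvalue of `M` from below (the real case of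
`le_eigenvalues_of_forall_re_form`). [cite: HornJohnson2013, Thm. 4.2.2] -/
theorem le_eigenvalues_of_forall_form_real {M : Matrix n n ℝ} (hM : M.IsHermitian) {lam : ℝ}
    (h : ∀ x : n → ℝ, lam * (x ⬝ᵥ x) ≤ x ⬝ᵥ M *ᵥ x) (i : n) : lam ≤ hM.eigenvalues i := by
  refine le_eigenvalues_of_forall_re_form hM (fun v ↦ ?_) i
  have e1 : ∑ j, ‖v j‖ ^ 2 = v ⬝ᵥ v := by
    simp only [Real.norm_eq_abs, sq_abs]
    simp only [dotProduct, sq]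
  rw [e1, star_trivial, RCLike.re_to_real]
  exact h v

/-- **Rayleigh–Ritz, converse (real symmetric case)**: eigenvalues `≥ lam` give the form bound
`lam · xᵀx ≤ xᵀMx` (the real case of `mul_normSq_le_re_form_of_le_eigenvalues`).
[cite: HornJohnson2013, Thm. 4.2.2] -/
theorem forall_form_real_of_le_eigenvalues {M : Matrix n n ℝ} (hM : M.IsHermitian) {lam : ℝ}
    (h : ∀ i, lam ≤ hM.eigenvalues i) (x : n → ℝ) : lam * (x ⬝ᵥ x) ≤ x ⬝ᵥ M *ᵥ x := by
  have h1 := mul_normSq_le_re_form_of_le_eigenvalues hM h x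
  have e1 : ∑ j, ‖x j‖ ^ 2 = x ⬝ᵥ x := by
    simp only [Real.norm_eq_abs, sq_abs]
    simp only [dotProduct, sq]
  rw [e1, star_trivial, RCLike.re_to_real] at h1
  exact h1

/-- **Eigenvalue margin of an affine symmetric family over a box from vertex FORM bounds** (the
shape a certificate reader produces: one `LDLᵀ` form certificate per vertex): if
`lam · ‖x‖² ≤ xᵀ(A₀ + A(v))x` at every vertex `v`, then `lam ≤ λᵢ(A₀ + A(p))` for every `p` of the
box and every `i`. [cite: Hladik2017, Thm. 7 ((2) ⇒ (1)), margin form] -/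
theorem le_eigenvalues_affine_of_forall_vertex {A₀ : Matrix n n ℝ} {A : ι → Matrix n n ℝ}
    (hA₀ : A₀.IsHermitian) (hA : ∀ k, (A k).IsHermitian) {lo hi : ι → ℝ} {lam : ℝ}
    (hv : ∀ q, IsBoxVertex lo hi q → ∀ x : n → ℝ, lam * (x ⬝ᵥ x) ≤ x ⬝ᵥ (A₀ + paramMatrix A q) *ᵥ x)
    {p : ι → ℝ} (hp : p ∈ Set.Icc lo hi) (i : n) :
    lam ≤ (isHermitian_affine hA₀ hA p).eigenvalues i :=
  le_eigenvalues_of_forall_form_real _ (mul_dotProduct_affine_ge_of_forall_vertex A₀ A hv hp) i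

/-- **Eigenvalue margin from vertex EIGENVALUE bounds**: if every eigenvalue of `A₀ + A(v)` is
`≥ lam` at every vertex `v` of the box, then every eigenvalue of `A₀ + A(p)` is `≥ lam` at every
`p` of the box — `min_{p ∈ box} λ_min = min_{vertices} λ_min`. [cite: Hladik2017, Thm. 7, margin form] -/
theorem le_eigenvalues_affine_of_forall_vertex_eigenvalues {A₀ : Matrix n n ℝ} {A : ι → Matrix n n ℝ}
    (hA₀ : A₀.IsHermitian) (hA : ∀ k, (A k).IsHermitian) {lo hi : ι → ℝ} {lam : ℝ}
    (hv : ∀ q, IsBoxVertex lo hi q → ∀ j, lam ≤ (isHermitian_affine hA₀ hA q).eigenvalues j)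
    {p : ι → ℝ} (hp : p ∈ Set.Icc lo hi) (i : n) :
    lam ≤ (isHermitian_affine hA₀ hA p).eigenvalues i :=
  le_eigenvalues_affine_of_forall_vertex hA₀ hA
    (fun q hq x ↦ forall_form_real_of_le_eigenvalues _ (hv q hq) x) hp i

/-- **Vertices ⇔ box for eigenvalue margins** (box non-empty): `lam ≤ λᵢ(A₀ + A(p))` for all `p`
in the box and all `i` iff the same holds at the `2^K` vertices. [cite: Hladik2017, Thm. 7 ((1) ⇔ (2)), margin form] -/
theorem forall_mem_le_eigenvalues_affine_iff_forall_vertex {A₀ : Matrix n n ℝ} {A : ι → Matrix n n ℝ}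
    (hA₀ : A₀.IsHermitian) (hA : ∀ k, (A k).IsHermitian) {lo hi : ι → ℝ} (hlh : lo ≤ hi) (lam : ℝ) :
    (∀ p ∈ Set.Icc lo hi, ∀ i, lam ≤ (isHermitian_affine hA₀ hA p).eigenvalues i) ↔
      ∀ q, IsBoxVertex lo hi q → ∀ i, lam ≤ (isHermitian_affine hA₀ hA q).eigenvalues i :=
  ⟨fun h q hq i => h q (hq.mem_Icc hlh) i,
    fun h _ hp i => le_eigenvalues_affine_of_forall_vertex_eigenvalues hA₀ hA h hp i⟩

/-- **Positive definiteness with a margin**: vertex form bounds with `lam > 0` make every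
`A₀ + A(p)`, `p` in the box, positive definite (the affine analogue of `posDef_of_forall_vertex`).
[cite: Hladik2017, Thm. 7 ((2) ⇒ (1))] -/
theorem posDef_affine_of_forall_vertex {A₀ : Matrix n n ℝ} {A : ι → Matrix n n ℝ}
    (hA₀ : A₀.IsHermitian) (hA : ∀ k, (A k).IsHermitian) {lo hi : ι → ℝ} {lam : ℝ} (hlam : 0 < lam)
    (hv : ∀ q, IsBoxVertex lo hi q → ∀ x : n → ℝ, lam * (x ⬝ᵥ x) ≤ x ⬝ᵥ (A₀ + paramMatrix A q) *ᵥ x)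
    {p : ι → ℝ} (hp : p ∈ Set.Icc lo hi) : (A₀ + paramMatrix A p).PosDef :=
  (isHermitian_affine hA₀ hA p).posDef_iff_eigenvalues_pos.2 fun i ↦
    hlam.trans_le (le_eigenvalues_affine_of_forall_vertex hA₀ hA hv hp i)

/-! ### Pencil margins `m · xᵀK(p)x ≤ xᵀW(p)x` (energy-principle / generalised-eigenvalue form) -/

omit [Fintype n] [DecidableEq n] in
/-- The linear part of the shifted pencil family: with `A^{(k)} := W^{(k)} − m·K^{(k)}`,
`A(p) = W(p) − m·K(p)` (plumbing). [folklore] -/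
private theorem paramMatrix_sub_smul (W K : ι → Matrix n n ℝ) (m : ℝ) (p : ι → ℝ) :
    paramMatrix (fun k ↦ W k - m • K k) p = paramMatrix W p - m • paramMatrix K p := by
  unfold paramMatrix
  rw [Finset.smul_sum, ← Finset.sum_sub_distrib]
  refine Finset.sum_congr rfl fun k _ ↦ ?_
  rw [smul_sub, smul_comm (p k) m (K k)]

omit [DecidableEq n] in
/-- The form of the shifted pencil family is `xᵀW(p)x − m · xᵀK(p)x` (plumbing). [folklore] -/
private theorem form_pencil_eq (W₀ K₀ : Matrix n n ℝ) (W K : ι → Matrix n n ℝ) (m : ℝ)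
    (p : ι → ℝ) (x : n → ℝ) :
    x ⬝ᵥ ((W₀ - m • K₀) + paramMatrix (fun k ↦ W k - m • K k) p) *ᵥ x
      = x ⬝ᵥ (W₀ + paramMatrix W p) *ᵥ x - m * (x ⬝ᵥ (K₀ + paramMatrix K p) *ᵥ x) := by
  rw [paramMatrix_sub_smul]
  have e : (W₀ - m • K₀) + (paramMatrix W p - m • paramMatrix K p)
      = (W₀ + paramMatrix W p) - m • (K₀ + paramMatrix K p) := by
    rw [smul_add]; abel
  rw [e, Matrix.sub_mulVec, dotProduct_sub, Matrix.smul_mulVec, dotProduct_smul, smul_eq_mul]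

omit [DecidableEq n] in
/-- **Pencil margin of two affine families over a box from vertex FORM bounds** (Hladík's vertex
theorem applied to the affine family `W(p) − m·K(p)` with margin `0`): if
`m · xᵀK(v)x ≤ xᵀW(v)x` for every vertex `v` of the box `[p̲, p̄]` and every `x`, then the same holds
at every `p ∈ [p̲, p̄]` — the discrete energy-principle margin `δW_h[ξ] ≥ m‖ξ‖²_K` uniformly on the
box. No symmetry and no definiteness of `K` is needed for this inequality; `m` is FIXED before the
vertex test. [cite: Hladik2017, Thm. 7 ((2) ⇒ (1)), margin form for the family `W − m K`] -/
theorem pencil_form_ge_affine_of_forall_vertex (W₀ K₀ : Matrix n n ℝ) (W K : ι → Matrix n n ℝ)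
    {lo hi : ι → ℝ} {m : ℝ}
    (hv : ∀ q, IsBoxVertex lo hi q → ∀ x : n → ℝ,
      m * (x ⬝ᵥ (K₀ + paramMatrix K q) *ᵥ x) ≤ x ⬝ᵥ (W₀ + paramMatrix W q) *ᵥ x)
    {p : ι → ℝ} (hp : p ∈ Set.Icc lo hi) (x : n → ℝ) :
    m * (x ⬝ᵥ (K₀ + paramMatrix K p) *ᵥ x) ≤ x ⬝ᵥ (W₀ + paramMatrix W p) *ᵥ x := by
  have h := mul_dotProduct_affine_ge_of_forall_vertex (W₀ - m • K₀) (fun k ↦ W k - m • K k)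
    (lo := lo) (hi := hi) (lam := 0) (fun q hq y ↦ ?_) hp x
  · rw [zero_mul, form_pencil_eq] at h
    linarith
  · rw [zero_mul, form_pencil_eq]
    linarith [hv q hq y]

omit [DecidableEq n] in
/-- **Vertices ⇔ box for pencil margins** (box non-empty, `p̲ ≤ p̄`, margin `m` fixed):
`m · xᵀK(p)x ≤ xᵀW(p)x` for all `p` in the box and all `x` iff the same holds at the `2^K` vertices.
[cite: Hladik2017, Thm. 7 ((1) ⇔ (2)), margin form for the family `W − m K`] -/
theorem forall_mem_pencil_form_ge_affine_iff_forall_vertex (W₀ K₀ : Matrix n n ℝ)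
    (W K : ι → Matrix n n ℝ) {lo hi : ι → ℝ} (hlh : lo ≤ hi) (m : ℝ) :
    (∀ p ∈ Set.Icc lo hi, ∀ x : n → ℝ,
        m * (x ⬝ᵥ (K₀ + paramMatrix K p) *ᵥ x) ≤ x ⬝ᵥ (W₀ + paramMatrix W p) *ᵥ x) ↔
      ∀ q, IsBoxVertex lo hi q → ∀ x : n → ℝ,
        m * (x ⬝ᵥ (K₀ + paramMatrix K q) *ᵥ x) ≤ x ⬝ᵥ (W₀ + paramMatrix W q) *ᵥ x :=
  ⟨fun h q hq x => h q (hq.mem_Icc hlh) x,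
    fun h _ hp x => pencil_form_ge_affine_of_forall_vertex W₀ K₀ W K h hp x⟩

omit [DecidableEq n] in
/-- **Generalised Rayleigh-quotient bound for a symmetric-definite pencil family** (the reading a
pencil-margin certificate prints): vertex form bounds `m · xᵀK(v)x ≤ xᵀW(v)x` for the margin and
`κ · xᵀx ≤ xᵀK(v)x` with `κ > 0` for the definiteness of `K` give, at every `p` of the box and every
`x ≠ 0`, `xᵀK(p)x > 0` and `m ≤ xᵀW(p)x / xᵀK(p)x` — every generalised eigenvalue of
`(W(p), K(p))` (a stationary value of this quotient) is `≥ m`.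
[cite: Hladik2017, Thm. 7 ((2) ⇒ (1)), margin form, applied twice] -/
theorem le_pencil_rayleigh_affine_of_forall_vertex (W₀ K₀ : Matrix n n ℝ) (W K : ι → Matrix n n ℝ)
    {lo hi : ι → ℝ} {m κ : ℝ} (hκ : 0 < κ)
    (hK : ∀ q, IsBoxVertex lo hi q → ∀ x : n → ℝ, κ * (x ⬝ᵥ x) ≤ x ⬝ᵥ (K₀ + paramMatrix K q) *ᵥ x)
    (hv : ∀ q, IsBoxVertex lo hi q → ∀ x : n → ℝ,
      m * (x ⬝ᵥ (K₀ + paramMatrix K q) *ᵥ x) ≤ x ⬝ᵥ (W₀ + paramMatrix W q) *ᵥ x)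
    {p : ι → ℝ} (hp : p ∈ Set.Icc lo hi) {x : n → ℝ} (hx : x ≠ 0) :
    0 < x ⬝ᵥ (K₀ + paramMatrix K p) *ᵥ x ∧
      m ≤ (x ⬝ᵥ (W₀ + paramMatrix W p) *ᵥ x) / (x ⬝ᵥ (K₀ + paramMatrix K p) *ᵥ x) := by
  have hxx : 0 < x ⬝ᵥ x := by
    rcases Function.ne_iff.1 hx with ⟨i, hi⟩
    exact Finset.sum_pos' (fun j _ ↦ mul_self_nonneg (x j))
      ⟨i, Finset.mem_univ i, mul_self_pos.2 hi⟩
  have hKp : 0 < x ⬝ᵥ (K₀ + paramMatrix K p) *ᵥ x :=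
    (mul_pos hκ hxx).trans_le (mul_dotProduct_affine_ge_of_forall_vertex K₀ K hK hp x)
  exact ⟨hKp, (le_div_iff₀ hKp).2 (pencil_form_ge_affine_of_forall_vertex W₀ K₀ W K hv hp x)⟩

end ParametricEigenMargin

end Literature.Analysis.ValidatedNumerics
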